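import Mathlib

/-!
# Stub `stub_delaunayEdgeMoebius` — line `Sketch`, crux `VoronoiHubFromSmirnov` (stmt-CriticalPhenomena-6433)

Card "moebius-exact-delaunay-dilation-ward", first lemma: Möbius maps act exactly on Delaunay
adjacency.  An empty-circumdisc witness (`x`, `y` on the circle `‖p - z₀‖ = r`, no point of `X`
strictly inside) is carried by `ψ p = (a p + b)/(c p + d)` — whose pole `-d/c` lies strictly outside
the closed disc, and which is finite on `X` — to an empty-circumdisc witness for `ψ x`, `ψ y`.

Proof.  `c = 0`: `ψ` is affine and distances to `ψ z₀` scale by `‖a‖/‖d‖`.  `c ≠ 0`: with pole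
`P = -d/c` and `K = (bc - ad)/c²` one has `ψ p = a/c + K (p - P)⁻¹`; the inversion `u ↦ u⁻¹` maps
the circle `‖u - q‖ = r` (`q = z₀ - P`, `‖q‖ > r`) onto the circle of centre `q̄/m` and radius
`r/m`, `m = ‖q‖² - r²`, and its closed exterior onto the closed exterior, by the identity
`‖m - q̄ u‖² = r² ‖u‖² + m (‖u - q‖² - r²)`.  All [folklore].
-/

open Complex

namespace Summit.CriticalPhenomena.CardyFormulaZ2.Cruxes.VoronoiHubFromSmirnov.SketchLine

/-- Polynomial identity behind circle inversion: for real `m`, `r` and complex `u`, `q`,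
`|m - q̄ u|² = r² |u|² + m (|u - q|² - r²) + (|q|² - r² - m)(|u|² - m)`. [folklore] -/
theorem dm_normSq_inversion_identity (u q : ℂ) (r m : ℝ) :
    Complex.normSq ((m : ℂ) - (starRingEnd ℂ) q * u) =
      r ^ 2 * Complex.normSq u + m * (Complex.normSq (u - q) - r ^ 2) +
        (Complex.normSq q - r ^ 2 - m) * (Complex.normSq u - m) := by
  simp only [Complex.normSq_apply, Complex.sub_re, Complex.sub_im, Complex.mul_re, Complex.mul_im,
    Complex.conj_re, Complex.conj_im, Complex.ofReal_re, Complex.ofReal_im]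
  ring

/-- Norm form of the inversion identity at `m = ‖q‖² - r²`:
`‖m - q̄ u‖² = r² ‖u‖² + m (‖u - q‖² - r²)`. [folklore] -/
theorem dm_norm_sq_inversion (u q : ℂ) (r m : ℝ) (hm : m = ‖q‖ ^ 2 - r ^ 2) :
    ‖(m : ℂ) - (starRingEnd ℂ) q * u‖ ^ 2 = r ^ 2 * ‖u‖ ^ 2 + m * (‖u - q‖ ^ 2 - r ^ 2) := by
  simp only [Complex.sq_norm] at hm ⊢
  rw [dm_normSq_inversion_identity u q r m, hm]
  ring

/-- Inversion conjugated by a translation: `u⁻¹ - q̄/m = (m - q̄ u)/(m u)`, hence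
`‖u⁻¹ - q̄/m‖ = ‖m - q̄ u‖ / (m ‖u‖)` for `m > 0`, `u ≠ 0`. [folklore] -/
theorem dm_norm_inv_sub (u q : ℂ) (m : ℝ) (hm : 0 < m) (hu : u ≠ 0) :
    ‖u⁻¹ - (starRingEnd ℂ) q / (m : ℂ)‖ = ‖(m : ℂ) - (starRingEnd ℂ) q * u‖ / (m * ‖u‖) := by
  have hm' : (m : ℂ) ≠ 0 := Complex.ofReal_ne_zero.2 hm.ne'
  have h : u⁻¹ - (starRingEnd ℂ) q / (m : ℂ) =
      ((m : ℂ) - (starRingEnd ℂ) q * u) / ((m : ℂ) * u) := by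
    field_simp
  rw [h, norm_div, norm_mul, Complex.norm_of_nonneg hm.le]

/-- Inversion maps the circle `‖u - q‖ = r` (`‖q‖ > r > 0`) into the circle of centre `q̄/m` and
radius `r/m`, where `m = ‖q‖² - r²`. [folklore] -/
theorem dm_inv_circle_eq (u q : ℂ) (r m : ℝ) (hr : 0 < r) (hq : r < ‖q‖)
    (hm : m = ‖q‖ ^ 2 - r ^ 2) (hu : u ≠ 0) (h : ‖u - q‖ = r) :
    ‖u⁻¹ - (starRingEnd ℂ) q / (m : ℂ)‖ = r / m := by
  have hm0 : 0 < m := by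
    rw [hm, sub_pos]
    exact pow_lt_pow_left₀ hq hr.le two_ne_zero
  have hu0 : 0 < ‖u‖ := norm_pos_iff.2 hu
  have hsq := dm_norm_sq_inversion u q r m hm
  rw [h, sub_self, mul_zero, add_zero, ← mul_pow] at hsq
  have hN : ‖(m : ℂ) - (starRingEnd ℂ) q * u‖ = r * ‖u‖ :=
    (pow_left_inj₀ (norm_nonneg _) (by positivity) two_ne_zero).1 hsq
  rw [dm_norm_inv_sub u q m hm0 hu, hN, mul_comm m ‖u‖, mul_comm r ‖u‖,
    mul_div_mul_left r m hu0.ne']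

/-- Inversion maps the closed exterior of the circle `‖u - q‖ = r` (`‖q‖ > r > 0`, origin removed)
into the closed exterior of the circle of centre `q̄/m`, radius `r/m`, `m = ‖q‖² - r²`. [folklore] -/
theorem dm_inv_circle_le (u q : ℂ) (r m : ℝ) (hr : 0 < r) (hq : r < ‖q‖)
    (hm : m = ‖q‖ ^ 2 - r ^ 2) (hu : u ≠ 0) (h : r ≤ ‖u - q‖) :
    r / m ≤ ‖u⁻¹ - (starRingEnd ℂ) q / (m : ℂ)‖ := by
  have hm0 : 0 < m := by
    rw [hm, sub_pos]
    exact pow_lt_pow_left₀ hq hr.le two_ne_zero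
  have hu0 : 0 < ‖u‖ := norm_pos_iff.2 hu
  have hsq := dm_norm_sq_inversion u q r m hm
  have hle : (r * ‖u‖) ^ 2 ≤ ‖(m : ℂ) - (starRingEnd ℂ) q * u‖ ^ 2 := by
    rw [hsq, mul_pow]
    have h2 : r ^ 2 ≤ ‖u - q‖ ^ 2 := pow_le_pow_left₀ hr.le h 2
    nlinarith
  have hN : r * ‖u‖ ≤ ‖(m : ℂ) - (starRingEnd ℂ) q * u‖ :=
    (pow_le_pow_iff_left₀ (by positivity) (norm_nonneg _) two_ne_zero).1 hle
  rw [dm_norm_inv_sub u q m hm0 hu, le_div_iff₀ (by positivity)]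
  calc r / m * (m * ‖u‖) = r * ‖u‖ := by field_simp
    _ ≤ _ := hN

/-- **Möbius maps act exactly on Delaunay adjacency.**  If `x, y ∈ X` lie on the circle
`dist · z₀ = r` whose open disc contains no point of `X`, and `ψ p = (a p + b)/(c p + d)`
(`ad - bc ≠ 0`) has its pole strictly outside the closed disc and is finite on `X`, then `ψ x`,
`ψ y` lie on a circle `dist · w₀ = s`, `s > 0`, whose open disc contains no point of `ψ '' X`.
For `c ≠ 0` the witness is `w₀ = a/c + K q̄/m`, `s = ‖K‖ r/m` with `K = (bc - ad)/c²`,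
`q = z₀ + d/c`, `m = ‖q‖² - r²`; for `c = 0` it is `w₀ = ψ z₀`, `s = ‖a‖ r/‖d‖`. [folklore] -/
theorem stub_delaunayEdgeMoebius (a b c d : ℂ) (had : a * d - b * c ≠ 0) (X : Set ℂ) (x y : ℂ)
    (hx : x ∈ X) (hy : y ∈ X) (z₀ : ℂ) (r : ℝ) (hr : 0 < r)
    (hxs : dist x z₀ = r) (hys : dist y z₀ = r) (hempty : ∀ p ∈ X, r ≤ dist p z₀)
    (hpole : c ≠ 0 → r < dist (-d / c) z₀) (hX : ∀ p ∈ X, c * p + d ≠ 0) :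
    let ψ : ℂ → ℂ := fun p => (a * p + b) / (c * p + d)
    ∃ w₀ : ℂ, ∃ s : ℝ, 0 < s ∧ dist (ψ x) w₀ = s ∧ dist (ψ y) w₀ = s ∧
      ∀ p ∈ X, s ≤ dist (ψ p) w₀ := by
  intro ψ
  by_cases hc : c = 0
  · -- affine case: `ψ p = (a p + b)/d`, a similarity of ratio `‖a‖/‖d‖`
    subst hc
    have had' : a * d ≠ 0 := by simpa using had
    have ha : a ≠ 0 := left_ne_zero_of_mul had'
    have hd : d ≠ 0 := right_ne_zero_of_mul had'
    have key : ∀ p : ℂ, dist (ψ p) ((a * z₀ + b) / d) = ‖a‖ / ‖d‖ * dist p z₀ := by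
      intro p
      have h1 : ψ p = (a * p + b) / d := by
        simp only [ψ, zero_mul, zero_add]
      have h2 : (a * p + b) / d - (a * z₀ + b) / d = a / d * (p - z₀) := by
        field_simp
        ring
      rw [dist_eq_norm, dist_eq_norm, h1, h2, norm_mul, norm_div]
    refine ⟨(a * z₀ + b) / d, ‖a‖ / ‖d‖ * r, ?_, ?_, ?_, ?_⟩
    · exact mul_pos (div_pos (norm_pos_iff.2 ha) (norm_pos_iff.2 hd)) hr
    · rw [key, hxs]
    · rw [key, hys]
    · intro p hp
      rw [key]
      exact mul_le_mul_of_nonneg_left (hempty p hp) (by positivity)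
  · -- genuine Möbius case: translate the pole to the origin, invert, apply a similarity
    obtain ⟨P, hP⟩ : ∃ P : ℂ, P = -d / c := ⟨_, rfl⟩
    obtain ⟨K, hK⟩ : ∃ K : ℂ, K = (b * c - a * d) / c ^ 2 := ⟨_, rfl⟩
    obtain ⟨q, hq⟩ : ∃ q : ℂ, q = z₀ - P := ⟨_, rfl⟩
    obtain ⟨m, hm⟩ : ∃ m : ℝ, m = ‖q‖ ^ 2 - r ^ 2 := ⟨_, rfl⟩
    have hKne : K ≠ 0 := by
      rw [hK]
      refine div_ne_zero ?_ (pow_ne_zero 2 hc)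
      intro h0
      apply had
      linear_combination -h0
    have hqr : r < ‖q‖ := by
      have h := hpole hc
      rwa [← hP, dist_comm, dist_eq_norm, ← hq] at h
    have hm0 : 0 < m := by
      rw [hm, sub_pos]
      exact pow_lt_pow_left₀ hqr hr.le two_ne_zero
    have hu_eq : ∀ p : ℂ, p - P = (c * p + d) / c := by
      intro p
      rw [hP]
      field_simp
      ring
    have hu_ne : ∀ p : ℂ, c * p + d ≠ 0 → p - P ≠ 0 := by
      intro p hp
      rw [hu_eq p]
      exact div_ne_zero hp hc
    have huq : ∀ p : ℂ, (p - P) - q = p - z₀ := by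
      intro p
      rw [hq]
      ring
    have hψ : ∀ p : ℂ, c * p + d ≠ 0 → ψ p = a / c + K * (p - P)⁻¹ := by
      intro p hp
      show (a * p + b) / (c * p + d) = a / c + K * (p - P)⁻¹
      rw [hu_eq p, inv_div, hK]
      obtain ⟨D, hD⟩ : ∃ D : ℂ, D = c * p + d := ⟨_, rfl⟩
      rw [← hD] at hp ⊢
      field_simp
      rw [hD]
      ring
    have hdist : ∀ p : ℂ, c * p + d ≠ 0 →
        dist (ψ p) (a / c + K * ((starRingEnd ℂ) q / (m : ℂ))) =
          ‖K‖ * ‖(p - P)⁻¹ - (starRingEnd ℂ) q / (m : ℂ)‖ := by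
      intro p hp
      rw [dist_eq_norm, hψ p hp, ← norm_mul]
      congr 1
      ring
    refine ⟨a / c + K * ((starRingEnd ℂ) q / (m : ℂ)), ‖K‖ * (r / m), ?_, ?_, ?_, ?_⟩
    · exact mul_pos (norm_pos_iff.2 hKne) (div_pos hr hm0)
    · rw [hdist x (hX x hx), dm_inv_circle_eq (x - P) q r m hr hqr hm (hu_ne x (hX x hx))
        (by rw [huq, ← dist_eq_norm, hxs])]
    · rw [hdist y (hX y hy), dm_inv_circle_eq (y - P) q r m hr hqr hm (hu_ne y (hX y hy))
        (by rw [huq, ← dist_eq_norm, hys])]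
    · intro p hp
      rw [hdist p (hX p hp)]
      exact mul_le_mul_of_nonneg_left (dm_inv_circle_le (p - P) q r m hr hqr hm
        (hu_ne p (hX p hp)) (by rw [huq, ← dist_eq_norm]; exact hempty p hp)) (norm_nonneg K)

end Summit.CriticalPhenomena.CardyFormulaZ2.Cruxes.VoronoiHubFromSmirnov.SketchLine
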